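import Summits.ABC.IUTFork.Conditional.WRowHexLamSevenTriples
import Summits.ABC.IUTFork.Conditional.WRowUnconditionalCellsSlot
import HarnessLib

/-!
# R-W WINDOW-TABLE «W:HEX-INHABITED-BANDS» — the HEX family `λ_k = 1/2 + 2/7^k` at `k = 8`, EVERY prime level `l ≥ 73`: the hull licence S_H
# HOLDS at EVERY genuine Θ-volume datum over `(ratPoint λ_8, l)`, unconditionally — ONE theorem for the `k = 8` classes of the HEX universe

PROOF-ONLY file (D-0012; 0 definitions, 0 `Prop` facts) of the abc-iut cell — D-0079 RESCUE sub-cell R-W «WINDOW Θ-SIDE INEQUALITY», prover seat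
abc-iut-w5-d107 (gen 9), claim «W:HEX-INHABITED-BANDS» (lane P+, HOME/STATUS 2026-08-27T02:5xZ). The R-W numerics lead's table of record
(HOME/plan/rescue/R-W/WINDOW-TABLE.tsv v4.26, HSUM rows `lamSeven:k=8:l`) lists the classes `(λ_8, l)` as «INHABITED candidate (kernel iff p460046;
local inputs BY NAME)» with NO deciding theorem (every prime l ≥ 73 = ALL 9 tabulated classes (73 ≤ l ≤ 107, 137) and beyond — at p = 7 the floor-free cells serve l ≥ 79 and l = 73 uses the exact cells `WRow.hexcell_eight_small`; l ≤ 71 is the REFUTED side of record (abc-iut-rh-typ-4 `HexHullThreshold.not_pilotKummerCompatHull_lamSeven_even`)). This file decides them on the INHABITED side by ONE theorem. KEY REMARK: `λ_8 = (7⁸ + 4)/(2·7⁸) =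
5764805/11529602` is the Frey–Legendre point `a/c` of the abc triple `5764805 + 5764797 = 11529602` (`gcd = 1`: both summands odd, difference `8`), so abc-iut-W-row-1's
INTEGER-SLOT triple socket `WRow.licence_triple_unconditional_slot` (`Cor312LicenceTripleUnconditionalSlot`, inner radius `max(1, ⌊e/(p−1)⌋)` at every
odd bad prime) applies VERBATIM at a SYMBOLIC level `l`; its arithmetic hypothesis `hcell` is discharged uniformly in `l` — per bad prime `p` of
`abc = 2 · 3³ · 5 · 7⁸ · 41 · 61 · 89 · 461 · 2399` the admissible ramification indices are `e = m_p·l·n`, `e` is off the cyclotomic indices, and with ONE fixed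
envelope exponent per prime (A_3 = 0, A_5 = 0, A_7 = 3, A_41 = 0, A_61 = 0, A_89 = 0, A_461 = 0, A_2399 = 0) the two floor-free END-LABEL cells (`WRow.cell_wild_of_ends` p485154 / `WRow.cell_tameslot_of_ends`) are
quadratics in `(l−1)/2` settled by `nlinarith`; the result is then TRANSPORTED from the carrier `ratPoint (5764805/11529602)` to the table's carrier
`ratPoint ((2 : ℚ)⁻¹ + 2/7^8)` (`lamSeven_eq_hex8`). Nothing of abc-iut-W-row-1 / W-neg-1 / W-neg-2 / c312-5 / w4-d094 is restated: consumed BY NAME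
through the socket. TAKES NO SIDE on [IUTchIII] Cor. 3.12 (S. Mochizuki, *Inter-universal Teichmüller theory III*, Cor. 3.12 p. 173–174; Step (xi-f)
p. 184) or on any author; «inhabited as typed» ≠ «asserted in print».

WHAT IS PROVED (namespace `Summit.ABC.IUTFork.Conditional`): `isABCTriple_hex8`, `lamSeven_eq_hex8`, `eq_of_prime_dvd_triple_hex8`, `factorization_triple_hex8`,
`WRow.hcell_lamSeven_eight_all` (the arithmetic, every prime `l ≥ 73`), **`WRow.licence_lamSeven_eight_all`** — for `k = 8`, EVERY prime `l ≥ 73`, EVERY genuine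
Θ-volume datum `T` at `(ratPoint (1/2 + 2/7^k), l)` and EVERY pair of realising Θ- and q-ideles, abc-iut-c312-1's `Thm311ToCor312.Licence` HOLDS at
`settingPrVolSharp (pilotDataOfK T.D T.K) …`; **`WRow.exists_qPinned_and_hull_lamSeven_eight_all`** — branch C's «∃ ρ qK, QPinned ∧ PilotKummerCompatHull» there, any
columns. READING (neutral; numbers, not adjectives): the per-datum S_H object of the window certificates' binders (`hSHw` p447945 / `hSHwBad` p453137) is
INHABITED at the whole datum class `(λ_8, l)` for every prime `l ≥ 73`; no number-level and no local-type hypothesis is consumed. Admissibility / (P6) /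
Szpiro-badness of `(ratPoint λ_8, l)` and NON-EMPTINESS of the datum type are NOT claimed. HONEST SCOPE: OUR sharp containers; STRONGER-THAN-PRINT hull
reading; nothing about the printed inequality or any author's intended hull; typed ≠ proved; instantiated ≠ endorsed; no abc claim.
[cite: Mochizuki2012, IUTchI Def. 3.1 (b),(c) pp. 61–62, Rmk. 3.1.5 p. 65, Ex. 3.2 (iv) p. 71; IUTchIII Cor. 3.12 Step (xi-f) p. 184; IUTchIV Prop. 1.1 p. 9, Prop. 1.2 (i)(ii) p. 10, Prop. 1.4 (ii) p. 13, Cor. 2.2 (ii) proof (P5) p. 46]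
[cite: DupuyHilado2025, §3.3, §3.4, §4.9, §4.12] [cite: NeukirchANT1999, Ch. II (5.5)–(5.7)] [claim: Mochizuki2012, status: disputed] for every IUT sentence.
-/

noncomputable section

open Set Function Metric NumberField IsDedekindDomain

namespace Summit.ABC.IUTFork.Conditional

open Thm311 Thm311.Real Cor312 Cor312Vol Cor312Prov Literature.IUT.LogThetaLattice Literature.IUT.LogVolume
  Literature.IUT.HodgeTheaters Literature.IUT.LogVolume.Cor22
open Literature.NumberTheory.NumberFields Literature.NumberTheory.GaloisRepresentations.Ultrametric
open Literature.NumberTheory.DiophantineGeometry Literature.NumberTheory.DiophantineGeometry.GenEll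


/-! ## The arithmetic at a symbolic prime level `l ≥ 73` -/

/-- **The slot socket's arithmetic hypothesis `hcell` for `(5764805, 5764797, 11529602)` at EVERY prime level `l ≥ 73`.** Per prime of `abc` other than `2, l`:
the divisibilities the socket hands over force `e = m_p·l·n` (`n ≥ 1`), `e` is off the cyclotomic indices, and with the fixed exponents
A_3 = 0, A_5 = 0, A_7 = 3, A_41 = 0, A_61 = 0, A_89 = 0, A_461 = 0, A_2399 = 0 the two end-label floor-free cells (inner radius `⌊e/(p−1)⌋` at the wild `3, 5`, the integer slot `⌊e/6⌋` at `7`, the volume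
witness elsewhere) are quadratics in `(l−1)/2` with the sign settled by `nlinarith`; all labels and multiples by `WRow.cell_wild_of_ends` /
`WRow.cell_tameslot_of_ends`. [folklore] -/
theorem WRow.hcell_lamSeven_eight_all {l : ℕ} (hl : l.Prime) (hl0 : 73 ≤ l) :
    ∀ p : ℕ, p.Prime → p ∣ 5764805 * 5764797 * 11529602 → p ≠ 2 → p ≠ l → ∀ e : ℕ, 0 < e → l ∣ e →
      15 * l ∣ e * (5764805 * 5764797 * 11529602).factorization p → (p ∣ 30 → (p - 1) ∣ e) →
      (p ∣ 11529602 → Odd ((5764805 * 5764797 * 11529602).factorization p) → 30 * l ∣ e * (5764805 * 5764797 * 11529602).factorization p) →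
      (∀ k : ℕ, (e : ℤ) ≠ (p : ℤ) ^ k * ((p : ℤ) - 1)) ∧
      ∀ i : ℕ, i < (l - 1) / 2 →
        (e : ℤ) * ((((i + 1 : ℕ) : ℤ) ^ 2 * ((e * (2 * (5764805 * 5764797 * 11529602).factorization p) / (2 * l) : ℕ) : ℤ) -
            ((i + 1 : ℕ) : ℤ) * (((if p ∣ 30 ∧ ¬ p ∣ (5764805 * 5764797 * 11529602).factorization p then 2 * e - 1 else e - 1 : ℕ) : ℕ) : ℤ) -
            ((i + 2 : ℕ) : ℤ) * ((((max 1 (e / (p - 1))) : ℕ) : ℤ))) / (e : ℤ)) +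
          ((i + 2 : ℕ) : ℤ) * min ((p : ℤ) ^ (if p = 7 then 3 else 0) - ((if p = 7 then 3 else 0 : ℕ) : ℤ) * (e : ℤ))
            ((p : ℤ) ^ (if p = 7 then 4 else 1) - ((if p = 7 then 4 else 1 : ℕ) : ℤ) * (e : ℤ)) ≤
        ((e * (2 * (5764805 * 5764797 * 11529602).factorization p) / (2 * l) : ℕ) : ℤ) := by
  intro p hp hpabc h2 hpl e he _hle h15 h30 hodd
  rcases eq_of_prime_dvd_triple_hex8 hp hpabc with rfl | rfl | rfl | rfl | rfl | rfl | rfl | rfl | rfl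
  · exact absurd rfl h2
  · -- `p = 3`: `v_3(abc) = 3`, admissible `e = 10·l·n`, `A = 0`, shape mixed
    rw [factorization_triple_hex8.1] at h15 hodd ⊢
    have h15' : 5 * l * 3 ∣ e * 1 * 3 := by
      rw [show 5 * l * 3 = 15 * l by ring, show e * 1 * 3 = e * 3 by ring]; exact h15
    have hA : 5 * l ∣ e := by have := Nat.dvd_of_mul_dvd_mul_right (by norm_num) h15'; simpa using this
    have hq : 2 ∣ e := by have := h30 (by norm_num); norm_num at this; exact this
    have hcopq : Nat.Coprime 2 (5 * l) :=
      Nat.Coprime.mul_right (by norm_num) ((Nat.coprime_primes (by norm_num) hl).mpr (by omega))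
    have he0 : 10 * l ∣ e := by
      have := Nat.Coprime.mul_dvd_of_dvd_of_dvd hcopq hq hA; rwa [← mul_assoc, show (2 : ℕ) * 5 = 10 by norm_num] at this
    obtain ⟨n, rfl⟩ := he0
    have hn : 1 ≤ n := Nat.pos_of_ne_zero (by rintro rfl; simp at he)
    refine ⟨WRow.natCast_ne_pow_mul_sub_one (by norm_num : Nat.Prime 5) (by norm_num) (by norm_num) (by norm_num)
      ⟨2 * l * n, by ring⟩, fun i hi => ?_⟩
    rw [if_neg (by norm_num : ¬ ((3 : ℕ) ∣ 30 ∧ ¬ (3 : ℕ) ∣ 3))]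
    simp only [show ((3 : ℕ) = 7) = False from eq_false (by decide), ite_false]
    refine WRow.cell_tameslot_of_ends ((3 : ℕ) : ℤ) (10 * l) (3 - 1) (5 * l) (2 * 3) (2 * l) 0 1 ((l - 1) / 2) 1 (by norm_num) (by norm_num)
      (by omega) (by omega) ⟨30, by ring⟩ (by omega) le_rfl ?_ hi hn
    have hP : 10 * l * (2 * 3) / (2 * l) = 30 := Nat.div_eq_of_eq_mul_left (by omega) (by ring)
    have hpA : (((3 : ℕ) : ℤ)) ^ 0 = 1 := by norm_num
    rintro i (rfl | hi')
    · rw [hP, hpA]; push_cast; omega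
    · obtain ⟨k, hk⟩ := hl.odd_of_ne_two (by omega)
      have hl' : l = 2 * i + 3 := by omega
      subst hl'
      have hi0 : ((35 : ℕ) : ℤ) ≤ (i : ℤ) := by exact_mod_cast (show 35 ≤ i by omega)
      rw [hP, hpA]; push_cast at hi0 ⊢
      nlinarith [sq_nonneg (i : ℤ), mul_nonneg (sub_nonneg.mpr hi0) (show (0 : ℤ) ≤ (i : ℤ) by positivity)]
  · -- `p = 5`: `v_5(abc) = 1`, admissible `e = 60·l·n`, `A = 0`, shape wild
    rw [factorization_triple_hex8.2.1] at h15 hodd ⊢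
    have hA : 15 * l ∣ e := by simpa using h15
    have hq : 4 ∣ e := by have := h30 (by norm_num); norm_num at this; exact this
    have hcopq : Nat.Coprime 4 (15 * l) :=
      Nat.Coprime.mul_right (by norm_num) (by simpa using ((Nat.coprime_primes (by norm_num) hl).mpr (by omega) : Nat.Coprime 2 l).pow_left 2)
    have he0 : 60 * l ∣ e := by
      have := Nat.Coprime.mul_dvd_of_dvd_of_dvd hcopq hq hA; rwa [← mul_assoc, show (4 : ℕ) * 15 = 60 by norm_num] at this
    obtain ⟨n, rfl⟩ := he0
    have hn : 1 ≤ n := Nat.pos_of_ne_zero (by rintro rfl; simp at he)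
    refine ⟨WRow.natCast_ne_pow_mul_sub_one (by norm_num : Nat.Prime 3) (by norm_num) (by norm_num) (by norm_num)
      ⟨20 * l * n, by ring⟩, fun i hi => ?_⟩
    have hmax : 1 ≤ 60 * l * n / (5 - 1) := (Nat.le_div_iff_mul_le (by norm_num)).mpr (by nlinarith)
    rw [if_pos ⟨by norm_num, by norm_num⟩, max_eq_right hmax]
    simp only [show ((5 : ℕ) = 7) = False from eq_false (by decide), ite_false]
    refine WRow.cell_wild_of_ends ((5 : ℕ) : ℤ) (60 * l) (5 - 1) (2 * 1) (2 * l) 0 1 ((l - 1) / 2) (by norm_num) (by norm_num)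
      (Dvd.dvd.mul_right (by norm_num) l) (by omega) ⟨60, by ring⟩ (by omega) ?_ hi hn
    have hP : 60 * l * (2 * 1) / (2 * l) = 60 := Nat.div_eq_of_eq_mul_left (by omega) (by ring)
    have hR : 60 * l / (5 - 1) = 15 * l := by omega
    have hpA : (((5 : ℕ) : ℤ)) ^ 0 = 1 := by norm_num
    rintro i (rfl | hi')
    · rw [hP, hR, hpA]; push_cast; omega
    · obtain ⟨k, hk⟩ := hl.odd_of_ne_two (by omega)
      have hl' : l = 2 * i + 3 := by omega
      subst hl'
      have hi0 : ((35 : ℕ) : ℤ) ≤ (i : ℤ) := by exact_mod_cast (show 35 ≤ i by omega)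
      rw [hP, hR, hpA]; push_cast at hi0 ⊢
      nlinarith [sq_nonneg (i : ℤ), mul_nonneg (sub_nonneg.mpr hi0) (show (0 : ℤ) ≤ (i : ℤ) by positivity)]
  · -- `p = 7`: `v_7(abc) = 8`, admissible `e = 15·l·n`, `A = 3`, shape tame
    rw [factorization_triple_hex8.2.2.1] at h15 hodd ⊢
    have hcopv : Nat.Coprime (15 * l) 8 :=
      Nat.Coprime.mul_left (by norm_num) ((Nat.Prime.coprime_iff_not_dvd hl).mpr (fun h => by have := Nat.le_of_dvd (by norm_num) h; omega))
    have hA : 15 * l ∣ e := hcopv.dvd_of_dvd_mul_right h15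
    obtain ⟨n, rfl⟩ := hA
    have hn : 1 ≤ n := Nat.pos_of_ne_zero (by rintro rfl; simp at he)
    refine ⟨WRow.natCast_ne_pow_mul_sub_one (by norm_num : Nat.Prime 5) (by norm_num) (by norm_num) (by norm_num)
      ⟨3 * l * n, by ring⟩, fun i hi => ?_⟩
    rw [if_neg (by norm_num : ¬ ((7 : ℕ) ∣ 30 ∧ ¬ (7 : ℕ) ∣ 8))]
    simp only [ite_true]
    by_cases hthr : 79 ≤ l
    swap
    · exact WRow.hexcell_eight_small (l := l) (by interval_cases l <;> first | rfl | (exact absurd hl (by norm_num))) hn hi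
    · refine WRow.cell_tameslot_of_ends ((7 : ℕ) : ℤ) (15 * l) (7 - 1) (15 * l / 6) (2 * 8) (2 * l) 3 4 ((l - 1) / 2) 1 (by norm_num) (by norm_num)
        (by omega) (by omega) ⟨120, by ring⟩ (by omega) le_rfl ?_ hi hn
      have hP : 15 * l * (2 * 8) / (2 * l) = 120 := Nat.div_eq_of_eq_mul_left (by omega) (by ring)
      have hpA : (((7 : ℕ) : ℤ)) ^ 3 = 343 := by norm_num
      rintro i (rfl | hi')
      · rw [hP, hpA]; push_cast; omega
      · obtain ⟨k, hk⟩ := hl.odd_of_ne_two (by omega)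
        have hl' : l = 2 * i + 3 := by omega
        subst hl'
        have hi0 : ((38 : ℕ) : ℤ) ≤ (i : ℤ) := by exact_mod_cast (show 38 ≤ i by omega)
        have hr' : 15 * (2 * i + 3) ≤ 6 * (15 * (2 * i + 3) / 6) + 5 := by omega
        generalize 15 * (2 * i + 3) / 6 = ρ at hr' ⊢
        have hr'' : (15 : ℤ) * (2 * (i : ℤ) + 3) ≤ 6 * (ρ : ℤ) + 5 := by exact_mod_cast hr'
        rw [hP, hpA]; push_cast at hi0 ⊢
        nlinarith [sq_nonneg (i : ℤ), mul_nonneg (sub_nonneg.mpr hi0) (show (0 : ℤ) ≤ (i : ℤ) by positivity),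
          mul_le_mul_of_nonneg_left hr'' (show (0 : ℤ) ≤ (i : ℤ) + 2 by positivity)]
  · -- `p = 41`: `v_41(abc) = 1`, admissible `e = 15·l·n`, `A = 0`, shape tame
    rw [factorization_triple_hex8.2.2.2.1] at h15 hodd ⊢
    have hA : 15 * l ∣ e := by simpa using h15
    obtain ⟨n, rfl⟩ := hA
    have hn : 1 ≤ n := Nat.pos_of_ne_zero (by rintro rfl; simp at he)
    refine ⟨WRow.natCast_ne_pow_mul_sub_one (by norm_num : Nat.Prime 3) (by norm_num) (by norm_num) (by norm_num)
      ⟨5 * l * n, by ring⟩, fun i hi => ?_⟩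
    rw [if_neg (by norm_num : ¬ ((41 : ℕ) ∣ 30 ∧ ¬ (41 : ℕ) ∣ 1))]
    simp only [show ((41 : ℕ) = 7) = False from eq_false (by decide), ite_false]
    refine WRow.cell_tameslot_of_ends ((41 : ℕ) : ℤ) (15 * l) (41 - 1) 0 (2 * 1) (2 * l) 0 1 ((l - 1) / 2) 1 (by norm_num) (by norm_num)
      (by omega) (by omega) ⟨15, by ring⟩ (by omega) le_rfl ?_ hi hn
    have hP : 15 * l * (2 * 1) / (2 * l) = 15 := Nat.div_eq_of_eq_mul_left (by omega) (by ring)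
    have hpA : (((41 : ℕ) : ℤ)) ^ 0 = 1 := by norm_num
    rintro i (rfl | hi')
    · rw [hP, hpA]; push_cast; omega
    · obtain ⟨k, hk⟩ := hl.odd_of_ne_two (by omega)
      have hl' : l = 2 * i + 3 := by omega
      subst hl'
      have hi0 : ((35 : ℕ) : ℤ) ≤ (i : ℤ) := by exact_mod_cast (show 35 ≤ i by omega)
      rw [hP, hpA]; push_cast at hi0 ⊢
      nlinarith [sq_nonneg (i : ℤ), mul_nonneg (sub_nonneg.mpr hi0) (show (0 : ℤ) ≤ (i : ℤ) by positivity)]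
  · -- `p = 61`: `v_61(abc) = 1`, admissible `e = 15·l·n`, `A = 0`, shape tame
    rw [factorization_triple_hex8.2.2.2.2.1] at h15 hodd ⊢
    have hA : 15 * l ∣ e := by simpa using h15
    obtain ⟨n, rfl⟩ := hA
    have hn : 1 ≤ n := Nat.pos_of_ne_zero (by rintro rfl; simp at he)
    refine ⟨WRow.natCast_ne_pow_mul_sub_one hl (by norm_num : Nat.Prime 61) (by omega)
      (fun h => by have := Nat.le_of_dvd (by norm_num) h; omega) ⟨15 * n, by ring⟩, fun i hi => ?_⟩
    rw [if_neg (by norm_num : ¬ ((61 : ℕ) ∣ 30 ∧ ¬ (61 : ℕ) ∣ 1))]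
    simp only [show ((61 : ℕ) = 7) = False from eq_false (by decide), ite_false]
    refine WRow.cell_tameslot_of_ends ((61 : ℕ) : ℤ) (15 * l) (61 - 1) 0 (2 * 1) (2 * l) 0 1 ((l - 1) / 2) 1 (by norm_num) (by norm_num)
      (by omega) (by omega) ⟨15, by ring⟩ (by omega) le_rfl ?_ hi hn
    have hP : 15 * l * (2 * 1) / (2 * l) = 15 := Nat.div_eq_of_eq_mul_left (by omega) (by ring)
    have hpA : (((61 : ℕ) : ℤ)) ^ 0 = 1 := by norm_num
    rintro i (rfl | hi')
    · rw [hP, hpA]; push_cast; omega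
    · obtain ⟨k, hk⟩ := hl.odd_of_ne_two (by omega)
      have hl' : l = 2 * i + 3 := by omega
      subst hl'
      have hi0 : ((35 : ℕ) : ℤ) ≤ (i : ℤ) := by exact_mod_cast (show 35 ≤ i by omega)
      rw [hP, hpA]; push_cast at hi0 ⊢
      nlinarith [sq_nonneg (i : ℤ), mul_nonneg (sub_nonneg.mpr hi0) (show (0 : ℤ) ≤ (i : ℤ) by positivity)]
  · -- `p = 89`: `v_89(abc) = 1`, admissible `e = 15·l·n`, `A = 0`, shape tame
    rw [factorization_triple_hex8.2.2.2.2.2.1] at h15 hodd ⊢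
    have hA : 15 * l ∣ e := by simpa using h15
    obtain ⟨n, rfl⟩ := hA
    have hn : 1 ≤ n := Nat.pos_of_ne_zero (by rintro rfl; simp at he)
    refine ⟨WRow.natCast_ne_pow_mul_sub_one (by norm_num : Nat.Prime 5) (by norm_num) (by norm_num) (by norm_num)
      ⟨3 * l * n, by ring⟩, fun i hi => ?_⟩
    rw [if_neg (by norm_num : ¬ ((89 : ℕ) ∣ 30 ∧ ¬ (89 : ℕ) ∣ 1))]
    simp only [show ((89 : ℕ) = 7) = False from eq_false (by decide), ite_false]
    refine WRow.cell_tameslot_of_ends ((89 : ℕ) : ℤ) (15 * l) (89 - 1) 0 (2 * 1) (2 * l) 0 1 ((l - 1) / 2) 1 (by norm_num) (by norm_num)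
      (by omega) (by omega) ⟨15, by ring⟩ (by omega) le_rfl ?_ hi hn
    have hP : 15 * l * (2 * 1) / (2 * l) = 15 := Nat.div_eq_of_eq_mul_left (by omega) (by ring)
    have hpA : (((89 : ℕ) : ℤ)) ^ 0 = 1 := by norm_num
    rintro i (rfl | hi')
    · rw [hP, hpA]; push_cast; omega
    · obtain ⟨k, hk⟩ := hl.odd_of_ne_two (by omega)
      have hl' : l = 2 * i + 3 := by omega
      subst hl'
      have hi0 : ((35 : ℕ) : ℤ) ≤ (i : ℤ) := by exact_mod_cast (show 35 ≤ i by omega)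
      rw [hP, hpA]; push_cast at hi0 ⊢
      nlinarith [sq_nonneg (i : ℤ), mul_nonneg (sub_nonneg.mpr hi0) (show (0 : ℤ) ≤ (i : ℤ) by positivity)]
  · -- `p = 461`: `v_461(abc) = 1`, admissible `e = 15·l·n`, `A = 0`, shape tame
    rw [factorization_triple_hex8.2.2.2.2.2.2.1] at h15 hodd ⊢
    have hA : 15 * l ∣ e := by simpa using h15
    obtain ⟨n, rfl⟩ := hA
    have hn : 1 ≤ n := Nat.pos_of_ne_zero (by rintro rfl; simp at he)
    refine ⟨WRow.natCast_ne_pow_mul_sub_one (by norm_num : Nat.Prime 3) (by norm_num) (by norm_num) (by norm_num)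
      ⟨5 * l * n, by ring⟩, fun i hi => ?_⟩
    rw [if_neg (by norm_num : ¬ ((461 : ℕ) ∣ 30 ∧ ¬ (461 : ℕ) ∣ 1))]
    simp only [show ((461 : ℕ) = 7) = False from eq_false (by decide), ite_false]
    refine WRow.cell_tameslot_of_ends ((461 : ℕ) : ℤ) (15 * l) (461 - 1) 0 (2 * 1) (2 * l) 0 1 ((l - 1) / 2) 1 (by norm_num) (by norm_num)
      (by omega) (by omega) ⟨15, by ring⟩ (by omega) le_rfl ?_ hi hn
    have hP : 15 * l * (2 * 1) / (2 * l) = 15 := Nat.div_eq_of_eq_mul_left (by omega) (by ring)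
    have hpA : (((461 : ℕ) : ℤ)) ^ 0 = 1 := by norm_num
    rintro i (rfl | hi')
    · rw [hP, hpA]; push_cast; omega
    · obtain ⟨k, hk⟩ := hl.odd_of_ne_two (by omega)
      have hl' : l = 2 * i + 3 := by omega
      subst hl'
      have hi0 : ((35 : ℕ) : ℤ) ≤ (i : ℤ) := by exact_mod_cast (show 35 ≤ i by omega)
      rw [hP, hpA]; push_cast at hi0 ⊢
      nlinarith [sq_nonneg (i : ℤ), mul_nonneg (sub_nonneg.mpr hi0) (show (0 : ℤ) ≤ (i : ℤ) by positivity)]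
  · -- `p = 2399`: `v_2399(abc) = 1`, admissible `e = 15·l·n`, `A = 0`, shape tame
    rw [factorization_triple_hex8.2.2.2.2.2.2.2] at h15 hodd ⊢
    have hA : 15 * l ∣ e := by simpa using h15
    obtain ⟨n, rfl⟩ := hA
    have hn : 1 ≤ n := Nat.pos_of_ne_zero (by rintro rfl; simp at he)
    refine ⟨WRow.natCast_ne_pow_mul_sub_one (by norm_num : Nat.Prime 5) (by norm_num) (by norm_num) (by norm_num)
      ⟨3 * l * n, by ring⟩, fun i hi => ?_⟩
    rw [if_neg (by norm_num : ¬ ((2399 : ℕ) ∣ 30 ∧ ¬ (2399 : ℕ) ∣ 1))]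
    simp only [show ((2399 : ℕ) = 7) = False from eq_false (by decide), ite_false]
    refine WRow.cell_tameslot_of_ends ((2399 : ℕ) : ℤ) (15 * l) (2399 - 1) 0 (2 * 1) (2 * l) 0 1 ((l - 1) / 2) 1 (by norm_num) (by norm_num)
      (by omega) (by omega) ⟨15, by ring⟩ (by omega) le_rfl ?_ hi hn
    have hP : 15 * l * (2 * 1) / (2 * l) = 15 := Nat.div_eq_of_eq_mul_left (by omega) (by ring)
    have hpA : (((2399 : ℕ) : ℤ)) ^ 0 = 1 := by norm_num
    rintro i (rfl | hi')
    · rw [hP, hpA]; push_cast; omega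
    · obtain ⟨k, hk⟩ := hl.odd_of_ne_two (by omega)
      have hl' : l = 2 * i + 3 := by omega
      subst hl'
      have hi0 : ((35 : ℕ) : ℤ) ≤ (i : ℤ) := by exact_mod_cast (show 35 ≤ i by omega)
      rw [hP, hpA]; push_cast at hi0 ⊢
      nlinarith [sq_nonneg (i : ℤ), mul_nonneg (sub_nonneg.mpr hi0) (show (0 : ℤ) ≤ (i : ℤ) by positivity)]

/-! ## THE BAND: S_H INHABITED at every genuine datum over `(ratPoint λ_8, l)`, `λ_8 = 1/2 + 2/7⁸`, every prime `l ≥ 73` -/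

/-- **«W:HEX-INHABITED-BANDS», `k = 8`: for EVERY prime `l ≥ 73`**, every genuine Θ-volume datum `T` at `(ratPoint (1/2 + 2/7^8), l)`
([IUTchIV] Cor. 2.2 (ii) proof (P7); abc-iut-w5-d044's HEX family) and every pair of Θ- and q-ideles realising the pilot divisors of `X := pilotDataOfK T.D T.K`, abc-iut-c312-1's
`Thm311ToCor312.Licence` HOLDS at abc-iut-c312-7's `settingPrVolSharp X …` — `WRow.licence_triple_unconditional_slot` at `WRow.hcell_lamSeven_eight_all`, transported along `lamSeven_eq_hex8`.
[cite: Mochizuki2012, IUTchI Def. 3.1 (b),(c) pp. 61–62, Rmk. 3.1.5 p. 65, Ex. 3.2 (iv) p. 71; IUTchIII Cor. 3.12 Step (xi-f) p. 184; IUTchIV Prop. 1.1 p. 9, Prop. 1.2 (i)(ii) p. 10, Prop. 1.4 (ii) p. 13, Cor. 2.2 (ii) proof (P5) p. 46] [cite: DupuyHilado2025, §3.3, §3.4, §4.9, §4.12] [claim: Mochizuki2012, status: disputed] -/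
theorem WRow.licence_lamSeven_eight_all {k l : ℕ} (hk : k = 8) (hl : l.Prime) (hl0 : 73 ≤ l) (T : Cor22.ThetaVolumeDatumAt (ratPoint ((2 : ℚ)⁻¹ + 2 / 7 ^ k)) l) :
    letI := T.instFieldF; letI := T.instNumberFieldF; letI := T.instAlgebraF; letI := T.instFieldK
    letI := T.instNumberFieldK; letI := T.instAlgebraK; letI := T.instFieldFbar; letI := T.instAlgebraFbar
    letI := T.instAlgebraKFbar; letI := T.instIsElliptic
    ∀ {logv : PadicLogs T.K} (hlog : LogvAnalytic logv) (M : Type) [Field M] [NumberField M]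
      (archPk : ∀ (j : (thetaIndex (pilotDataOfK T.D T.K)).Label) (vQ : (thetaIndex (pilotDataOfK T.D T.K)).VQ),
        Set ((logShellsDH (pilotDataOfK T.D T.K) logv).Packet j vQ))
      (archSub : ∀ (j : (thetaIndex (pilotDataOfK T.D T.K)).Label) (v : (thetaIndex (pilotDataOfK T.D T.K)).V),
        Set ((logShellsDH (pilotDataOfK T.D T.K) logv).Packet j ((thetaIndex (pilotDataOfK T.D T.K)).over v)))
      (Ψ : ℤ → ∀ v : (thetaIndex (pilotDataOfK T.D T.K)).V, v ∈ (thetaIndex (pilotDataOfK T.D T.K)).Vbad →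
        Set ((logShellsDH (pilotDataOfK T.D T.K) logv).StarPacket v))
      (act : ℤ → ∀ v : (thetaIndex (pilotDataOfK T.D T.K)).V, v ∈ (thetaIndex (pilotDataOfK T.D T.K)).Vbad →
        (logShellsDH (pilotDataOfK T.D T.K) logv).StarPacket v → Module.End ℚ ((logShellsDH (pilotDataOfK T.D T.K) logv).StarPacket v))
      (Mmod : ℤ → ∀ j : (thetaIndex (pilotDataOfK T.D T.K)).LabelStar, Set ((logShellsDH (pilotDataOfK T.D T.K) logv).GlobalPacket j.1))
      (region : ℤ → ∀ j : (thetaIndex (pilotDataOfK T.D T.K)).LabelStar, FinDivisor M → ∀ vQ : (thetaIndex (pilotDataOfK T.D T.K)).VQ,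
        Set ((logShellsDH (pilotDataOfK T.D T.K) logv).Packet j.1 vQ))
      (n : ℤ) {HT : Type} {LogLink : HT → HT → Type} {IsFull : ∀ {s t : HT}, LogLink s t → Prop}
      (lat : LGPGaussianLogThetaLattice LogLink IsFull)
      {Frd : Type} {IsoF : Frd → Frd → Type} {Ob : Frd → Type} {realify : Frd → Frd} {Strip : Type}
      {IsoS : Strip → Strip → Type} {Mv : ∀ v : (thetaIndex (pilotDataOfK T.D T.K)).V, v ∈ (thetaIndex (pilotDataOfK T.D T.K)).Vbad → Type}
      [∀ v h, Monoid (Mv v h)]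
      (sig : GlobalLGPFrobenioidSignature (thetaIndex (pilotDataOfK T.D T.K)).lstar (thetaIndex (pilotDataOfK T.D T.K)).V
        (· ∈ (thetaIndex (pilotDataOfK T.D T.K)).Vbad) Frd IsoF Ob realify Strip IsoS Mv)
      (split : SplittingMonoids Mv) {ObΔ : Type} {N : ∀ v : (thetaIndex (pilotDataOfK T.D T.K)).V, v ∈ (thetaIndex (pilotDataOfK T.D T.K)).Vbad → Type}
      [∀ v h, Monoid (N v h)] (qData : QPilotData ObΔ N)
      (tq : ∀ (pp : Nat.Primes) (x : (thetaIndex (pilotDataOfK T.D T.K)).Fibre (.inr pp)),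
        haveI : Fact (pp : ℕ).Prime := ⟨pp.2⟩; kOf (pilotDataOfK T.D T.K) pp.1 x)
      (t : ∀ (pp : Nat.Primes) (_ : Fin (pilotDataOfK T.D T.K).lstar) (x : (thetaIndex (pilotDataOfK T.D T.K)).Fibre (.inr pp)),
        haveI : Fact (pp : ℕ).Prime := ⟨pp.2⟩; kOf (pilotDataOfK T.D T.K) pp.1 x)
      (htq0 : ∀ pp x, tq pp x ≠ 0)
      (htq1 : ∀ (pp : Nat.Primes) (x : (thetaIndex (pilotDataOfK T.D T.K)).Fibre (.inr pp)),
        haveI : Fact (pp : ℕ).Prime := ⟨pp.2⟩; placeOf (pilotDataOfK T.D T.K) pp.1 x ∉ (pilotDataOfK T.D T.K).S → ‖tq pp x‖ = 1)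
      (_ht0 : ∀ pp i x, t pp i x ≠ 0)
      (_ht : ∀ (pp : Nat.Primes) (i : Fin (pilotDataOfK T.D T.K).lstar) (x : (thetaIndex (pilotDataOfK T.D T.K)).Fibre (.inr pp)),
        haveI : Fact (pp : ℕ).Prime := ⟨pp.2⟩
        Real.log ‖t pp i x‖ = -((pilotDataOfK T.D T.K).thetaPilot i (placeOf (pilotDataOfK T.D T.K) pp.1 x)) *
          logNorm T.K (placeOf (pilotDataOfK T.D T.K) pp.1 x) / localDegree T.K (placeOf (pilotDataOfK T.D T.K) pp.1 x))
      (_htq : ∀ (pp : Nat.Primes) (x : (thetaIndex (pilotDataOfK T.D T.K)).Fibre (.inr pp)),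
        haveI : Fact (pp : ℕ).Prime := ⟨pp.2⟩
        Real.log ‖tq pp x‖ = -((pilotDataOfK T.D T.K).qPilot (placeOf (pilotDataOfK T.D T.K) pp.1 x)) *
          logNorm T.K (placeOf (pilotDataOfK T.D T.K) pp.1 x) / localDegree T.K (placeOf (pilotDataOfK T.D T.K) pp.1 x)),
      Thm311ToCor312.Licence
        (settingPrVolSharp (pilotDataOfK T.D T.K) hlog M archPk archSub Ψ act Mmod region n lat sig split qData tq t htq0 htq1) := by
  subst hk
  revert T
  rw [lamSeven_eq_hex8]
  intro T
  exact WRow.licence_triple_unconditional_slot isABCTriple_hex8 (by rw [Cor22.jInv_ratPoint_triple isABCTriple_hex8]; norm_num) T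
    (fun p => if p = 7 then 3 else 0) (fun p => if p = 7 then 4 else 1) (WRow.hcell_lamSeven_eight_all hl hl0)

/-- **BRANCH C's PER-DATUM ANTECEDENT «∃ ρ qK, QPinned ∧ PilotKummerCompatHull» at every genuine datum over `(ratPoint (1/2 + 2/7^8), l)`, EVERY prime
`l ≥ 73`** (any columns `col`; every pair of realising Θ- and q-ideles, the CHOSEN ones of the window certificates' `hSHw`/`hSHwBad` binders
included): the per-datum S_H object of the certificates of record (p453137 / p450130 / p447945) HOLDS at every such datum class, UNCONDITIONALLY.
[cite: Mochizuki2012, IUTchIII Cor. 3.12 Step (xi-d) p. 183, (xi-f) p. 184] [cite: DupuyHilado2025, §3.3, §3.4, §4.9] [claim: Mochizuki2012, status: disputed] -/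
theorem WRow.exists_qPinned_and_hull_lamSeven_eight_all {k l : ℕ} (hk : k = 8) (hl : l.Prime) (hl0 : 73 ≤ l) (T : Cor22.ThetaVolumeDatumAt (ratPoint ((2 : ℚ)⁻¹ + 2 / 7 ^ k)) l) :
    letI := T.instFieldF; letI := T.instNumberFieldF; letI := T.instAlgebraF; letI := T.instFieldK
    letI := T.instNumberFieldK; letI := T.instAlgebraK; letI := T.instFieldFbar; letI := T.instAlgebraFbar
    letI := T.instAlgebraKFbar; letI := T.instIsElliptic
    ∀ {logv : PadicLogs T.K} (hlog : LogvAnalytic logv) (M : Type) [Field M] [NumberField M]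
      (archPk : ∀ (j : (thetaIndex (pilotDataOfK T.D T.K)).Label) (vQ : (thetaIndex (pilotDataOfK T.D T.K)).VQ),
        Set ((logShellsDH (pilotDataOfK T.D T.K) logv).Packet j vQ))
      (archSub : ∀ (j : (thetaIndex (pilotDataOfK T.D T.K)).Label) (v : (thetaIndex (pilotDataOfK T.D T.K)).V),
        Set ((logShellsDH (pilotDataOfK T.D T.K) logv).Packet j ((thetaIndex (pilotDataOfK T.D T.K)).over v)))
      (Ψ : ℤ → ∀ v : (thetaIndex (pilotDataOfK T.D T.K)).V, v ∈ (thetaIndex (pilotDataOfK T.D T.K)).Vbad →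
        Set ((logShellsDH (pilotDataOfK T.D T.K) logv).StarPacket v))
      (act : ℤ → ∀ v : (thetaIndex (pilotDataOfK T.D T.K)).V, v ∈ (thetaIndex (pilotDataOfK T.D T.K)).Vbad →
        (logShellsDH (pilotDataOfK T.D T.K) logv).StarPacket v → Module.End ℚ ((logShellsDH (pilotDataOfK T.D T.K) logv).StarPacket v))
      (Mmod : ℤ → ∀ j : (thetaIndex (pilotDataOfK T.D T.K)).LabelStar, Set ((logShellsDH (pilotDataOfK T.D T.K) logv).GlobalPacket j.1))
      (region : ℤ → ∀ j : (thetaIndex (pilotDataOfK T.D T.K)).LabelStar, FinDivisor M → ∀ vQ : (thetaIndex (pilotDataOfK T.D T.K)).VQ,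
        Set ((logShellsDH (pilotDataOfK T.D T.K) logv).Packet j.1 vQ))
      (n : ℤ) {HT : Type} {LogLink : HT → HT → Type} {IsFull : ∀ {s t : HT}, LogLink s t → Prop}
      (lat : LGPGaussianLogThetaLattice LogLink IsFull)
      {Frd : Type} {IsoF : Frd → Frd → Type} {Ob : Frd → Type} {realify : Frd → Frd} {Strip : Type}
      {IsoS : Strip → Strip → Type} {Mv : ∀ v : (thetaIndex (pilotDataOfK T.D T.K)).V, v ∈ (thetaIndex (pilotDataOfK T.D T.K)).Vbad → Type}
      [∀ v h, Monoid (Mv v h)]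
      (sig : GlobalLGPFrobenioidSignature (thetaIndex (pilotDataOfK T.D T.K)).lstar (thetaIndex (pilotDataOfK T.D T.K)).V
        (· ∈ (thetaIndex (pilotDataOfK T.D T.K)).Vbad) Frd IsoF Ob realify Strip IsoS Mv)
      (split : SplittingMonoids Mv) {ObΔ : Type} {N : ∀ v : (thetaIndex (pilotDataOfK T.D T.K)).V, v ∈ (thetaIndex (pilotDataOfK T.D T.K)).Vbad → Type}
      [∀ v h, Monoid (N v h)] (qData : QPilotData ObΔ N)
      (tq : ∀ (pp : Nat.Primes) (x : (thetaIndex (pilotDataOfK T.D T.K)).Fibre (.inr pp)),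
        haveI : Fact (pp : ℕ).Prime := ⟨pp.2⟩; kOf (pilotDataOfK T.D T.K) pp.1 x)
      (t : ∀ (pp : Nat.Primes) (_ : Fin (pilotDataOfK T.D T.K).lstar) (x : (thetaIndex (pilotDataOfK T.D T.K)).Fibre (.inr pp)),
        haveI : Fact (pp : ℕ).Prime := ⟨pp.2⟩; kOf (pilotDataOfK T.D T.K) pp.1 x)
      (htq0 : ∀ pp x, tq pp x ≠ 0)
      (htq1 : ∀ (pp : Nat.Primes) (x : (thetaIndex (pilotDataOfK T.D T.K)).Fibre (.inr pp)),
        haveI : Fact (pp : ℕ).Prime := ⟨pp.2⟩; placeOf (pilotDataOfK T.D T.K) pp.1 x ∉ (pilotDataOfK T.D T.K).S → ‖tq pp x‖ = 1)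
      (col : ℤ → Column (logShellsDH (pilotDataOfK T.D T.K) logv))
      (_ht0 : ∀ pp i x, t pp i x ≠ 0)
      (_ht : ∀ (pp : Nat.Primes) (i : Fin (pilotDataOfK T.D T.K).lstar) (x : (thetaIndex (pilotDataOfK T.D T.K)).Fibre (.inr pp)),
        haveI : Fact (pp : ℕ).Prime := ⟨pp.2⟩
        Real.log ‖t pp i x‖ = -((pilotDataOfK T.D T.K).thetaPilot i (placeOf (pilotDataOfK T.D T.K) pp.1 x)) *
          logNorm T.K (placeOf (pilotDataOfK T.D T.K) pp.1 x) / localDegree T.K (placeOf (pilotDataOfK T.D T.K) pp.1 x))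
      (_htq : ∀ (pp : Nat.Primes) (x : (thetaIndex (pilotDataOfK T.D T.K)).Fibre (.inr pp)),
        haveI : Fact (pp : ℕ).Prime := ⟨pp.2⟩
        Real.log ‖tq pp x‖ = -((pilotDataOfK T.D T.K).qPilot (placeOf (pilotDataOfK T.D T.K) pp.1 x)) *
          logNorm T.K (placeOf (pilotDataOfK T.D T.K) pp.1 x) / localDegree T.K (placeOf (pilotDataOfK T.D T.K) pp.1 x)),
      ∃ (ρ : (∀ v : (thetaIndex (pilotDataOfK T.D T.K)).V, v ∈ (thetaIndex (pilotDataOfK T.D T.K)).Vbad →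
              Set ((logShellsDH (pilotDataOfK T.D T.K) logv).StarPacket v)) →
            ∀ (j : (thetaIndex (pilotDataOfK T.D T.K)).Label) (vQ : (thetaIndex (pilotDataOfK T.D T.K)).VQ),
              Set ((logShellsDH (pilotDataOfK T.D T.K) logv).Packet j vQ))
          (qK : ∀ v : (thetaIndex (pilotDataOfK T.D T.K)).V, v ∈ (thetaIndex (pilotDataOfK T.D T.K)).Vbad →
            Set ((logShellsDH (pilotDataOfK T.D T.K) logv).StarPacket v)),
          QPinned ({ toSituation := situationPrVol (pilotDataOfK T.D T.K) hlog M archPk archSub Ψ act Mmod region, col := col } :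
              LatticeSituation (thetaIndex (pilotDataOfK T.D T.K)))
            (settingPrVolSharp (pilotDataOfK T.D T.K) hlog M archPk archSub Ψ act Mmod region n lat sig split qData tq t htq0 htq1) ρ qK ∧
          PilotKummerCompatHull ({ toSituation := situationPrVol (pilotDataOfK T.D T.K) hlog M archPk archSub Ψ act Mmod region, col := col } :
              LatticeSituation (thetaIndex (pilotDataOfK T.D T.K)))
            (settingPrVolSharp (pilotDataOfK T.D T.K) hlog M archPk archSub Ψ act Mmod region n lat sig split qData tq t htq0 htq1) ρ qK := by
  subst hk
  revert T
  rw [lamSeven_eq_hex8]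
  intro T
  exact WRow.exists_qPinned_and_hull_triple_unconditional_slot isABCTriple_hex8 (by rw [Cor22.jInv_ratPoint_triple isABCTriple_hex8]; norm_num) T
    (fun p => if p = 7 then 3 else 0) (fun p => if p = 7 then 4 else 1) (WRow.hcell_lamSeven_eight_all hl hl0)

end Summit.ABC.IUTFork.Conditional

end
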